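import Mathlib
import Summits.QuantumFields.YangMills.Theses.FemtoCutoffLadder
import Summits.QuantumFields.YangMills.Theorems.FemtoCutoffLadderDyadicNestedUpperOfOctave

/-!
# SKELETON «octave-up» for the crux `DyadicNestedUpper` (stmt-QuantumFields-25766, route `FemtoCutoffLadder` rev 17; rung R2b1 = RECORD label)

Lead seat `ym-line-fcl-p1` g9 (2026-08-28).  25766 asks the VARIATIONAL (upper) nested comparison at every dyadic ratio `2^k`, uniformly in
`k` and in the base `L' ≥ L₀`.  ONE OCTAVE AT A TIME (lead g9, `Theorems/FemtoCutoffLadderUpperTowerTelescoping.lean` p611661 +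
`…DyadicNestedUpperOfOctave.lean`): the one-octave upper step «fine below coarse» with a SUMMABLE Symanzik-type defect `CΛ²/L'^σ` and the
telescoping asymptotic-scaling allowance `D(1/β' − 1/β)`, for every base `L' ≥ L₀`, telescopes up every tower to the `k`-uniform statement
(`C_DNU = max(C,0)/(1 − 2^{−σ}) + D`; `k = 0` = uniqueness of the matched coupling, `WindowMatching.beta_eq_of_window`, p610878).
So the ONE registered stub is

* `stub_octaveUpperDecay : OctaveUpperDecay` — the exact mirror image of `OctaveStepDecay` (24153) in the variational direction and for
  every base: `∃ C σ D lam₀ L₀`, `σ > 0`, `D ≥ 0`: matched `(β, 2L')`, `(β', L')`, `L' ≥ L₀` ⟹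
  `λ₁(L')^{L'}·λ₀(2L')^{2L'} ≤ exp(CΛ²/L'^σ + D(1/β' − 1/β))·λ₁(2L')^{2L'}·λ₀(L')^{L'}`, i.e. `z(Λ, 2L') ≤ z(Λ, L') + CΛ²/L'^σ + D(1/β'−1/β)`.
  HARDEST / ONLY (L–XL).  Door (landed by seat ym-line-sfw-p1 g10): `Dirichlet.fine_gap_le_dirichlet_of_pullback` — `λ₁(2L') ≥ λ₀(2L') −
  ℰ_Ω(g'∘B₂)/Var_Ω(g'∘B₂)` for the coarse excitation multiplier `g'` pulled back along the factor-2 block link map `B₂` (`BlockPullback.*`;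
  equivalently fcl-p3's ratio-2 thinning `thin`, `UpStep.upStepAt_of_dynComparisonAt`).  What remains: the fine ground-state Dirichlet energy
  per lattice step of `g'∘B₂` is `≤ ½(1 + O(Λ/L'^σ))×` the coarse one relative to the variances — ONE RG step (scales between `1/(2L')` and
  `1/L'`), at relative precision `O(Λ·L'^{−σ})` against the physical gap `ε₁Λ`.
ALTERNATIVE inside the line (not registered): the direct `2^k`-fold pull-back (`BlockPullback` with `M = 2^k`), `k`-uniform — lattice-`L'`-vs-
near-continuum control at once; the octave form trades `k`-uniformity for a decay rate, exactly as `OctaveStepDecay` does in the lower direction.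
Composition (kernel-checked, in the TREE): `dyadicNestedUpper_of_octaveUpperDecay` (p612260).
LEAD'S ARCHITECTURE NOTE (Cruxes/SubOctaveBounded/PICKED.md): under the «up» re-lining of 24085 the leaf needs only the INCOMMENSURABLE bounded
upper step at height 0 (`UpStepEv`), not 25766's `k`-uniformity; 25766 remains a legitimate stronger target and its octave stub is the natural
warm-up for the same machinery.  HONEST FRAMING: the stub is OPEN, behind `UVStabilityNonUniqueness`; R2b1 is a RECORD rung — not infinite
volume, not a mass gap, not Clay.  No summit is proved by this line.
-/

set_option autoImplicit false

noncomputable section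

open Summit.QuantumFields.YangMills.Theorems.FemtoTransferGap
open Summit.QuantumFields.YangMills.Theorems.FemtoCutoffLadder
open Summit.QuantumFields.YangMills.Theses.FemtoCutoffLadder

namespace Summit.QuantumFields.YangMills.Cruxes.DyadicNestedUpper.OctaveUp

/-- **(U₈) — the one-octave UPPER step with decay, every base** (verbatim the hypothesis of `dyadicNestedUpper_of_octaveUpperDecay`). -/
def OctaveUpperDecay : Prop :=
  ∃ (C σ D lam0 : ℝ) (L0 : ℕ), 0 < σ ∧ 0 < lam0 ∧ 0 ≤ D ∧ ∀ lam : ℝ, 0 < lam → lam ≤ lam0 →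
    ∀ (L' : ℕ) [NeZero L'] (L : ℕ) [NeZero L], L0 ≤ L' → L = 2 * L' →
      ∀ β β' : ℝ, InFemtoWindow lam β L → InFemtoWindow lam β' L' → luscherLambda β L = luscherLambda β' L' →
        secondValue su2Rep L' β' ^ L' * topValue su2Rep L β ^ L ≤
          Real.exp (C * luscherLambda β L ^ 2 / (L' : ℝ) ^ σ + D * (1 / β' - 1 / β)) *
            (secondValue su2Rep L β ^ L * topValue su2Rep L' β' ^ L')

/-- stub (the ONLY one; HARDEST; L–XL): the one-octave upper step with decay, every base `L' ≥ L₀`. -/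
theorem stub_octaveUpperDecay : OctaveUpperDecay := by
  sorry

/-- ★ The crux child BY NAME from exactly the one declared stub (kernel-checked composition p611661 + p612260:
`dyadicNestedUpper_of_octaveUpperDecay`). -/
theorem DyadicNestedUpper_holds_of_stubs : DyadicNestedUpper :=
  dyadicNestedUpper_of_octaveUpperDecay stub_octaveUpperDecay

end Summit.QuantumFields.YangMills.Cruxes.DyadicNestedUpper.OctaveUp

end
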